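import Mathlib
import Literature.NumberTheory.Transcendental.DrinfeldAssociatorHexagonProofs
import Literature.NumberTheory.Transcendental.DrinfeldAssociatorPentagonProofs
import HarnessLib

/-!
# Drinfeld's theorem: `(2πi, Φ_KZ)` satisfies the GT-relations

Discharge of the named fact `drinfeldAssociator_isAssociatorPair` of `DrinfeldAssociator.lean`
([Drinfeld1991, (2.12), (2.13), (5.3)]; [Furusho2011, §1]: "It is shown in [Dr] that `Φ_KZ`
satisfies GT-relations (with `μ = 2πi`) by using symmetry of the KZ-system on configuration
spaces"): `Φ_KZ` is group-like (`drinfeldAssociator_isGroupLike_holds`, the regularised shuffle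
relations of MZVs), satisfies Drinfeld's pentagon (`drinfeldAssociator_pentagon_holds`,
`DrinfeldAssociatorPentagonProofs.lean`: the KZ connection on the pentagon cell of `M_{0,5}(ℝ)`),
and `(2πi, Φ_KZ)` satisfies both hexagon equations (`drinfeldAssociator_hexagons`,
`DrinfeldAssociatorHexagonProofs.lean`: monodromy of the KZ equation on `ℙ¹ ∖ {0,1,∞}` and its
`ℤ/3`-symmetry `z ↦ 1/(1-z)`, giving the 2-cycle and 3-cycle relations, then [Furusho2010, Lemma 7]).
Everything is proved; no named fact is introduced.

## References

* V. G. Drinfel'd, *On quasitriangular quasi-Hopf algebras and on a group that is closely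
  connected with Gal(Q̄/Q)*, Leningrad Math. J. 2 (1991), 829–860, §2, (2.12), (2.13), §5, (5.3).
  [Drinfeld1991]
* H. Furusho, *Double shuffle relation for associators*, Ann. of Math. 174 (2011), §1.
  [Furusho2011]
-/

namespace Literature.NumberTheory.Transcendental

/-- **Drinfeld's theorem** [Drinfeld1991, §2, §5]: the pair `(2πi, Φ_KZ)` satisfies the
GT-relations — `Φ_KZ` is group-like, satisfies the pentagon equation, and `(2πi, Φ_KZ)` satisfies
the two hexagon equations — in `ℂ⟨⟨X₀, X₁⟩⟩`. Discharges `drinfeldAssociator_isAssociatorPair`.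
[cite: Furusho2011, §1] -/
theorem drinfeldAssociator_isAssociatorPair_holds : drinfeldAssociator_isAssociatorPair :=
  drinfeldAssociator_isAssociatorPair_of_pentagon' drinfeldAssociator_pentagon_holds

end Literature.NumberTheory.Transcendental
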